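import Summits.ABC.IUTFork.Conditional.WRowHexLamSevenAllKEventually
import Summits.ABC.IUTFork.Conditional.WRowLicenceNonCyclotomicLevels
import HarnessLib

/-!
# R-W WINDOW numerics («W:HEX-UNIFORM-K», part U1 (iii)): the HEX family `λ_k = 1/2 + 2/7^k` at EVERY `k ≥ 1` — S_H at every genuine
# Θ-volume datum over `(ratPoint λ_k, l)` at every NON-CYCLOTOMIC prime level `l` (abc-iut-C-cert-2's orbit socket, symbolic `k`)

PROOF-ONLY file (D-0012; 0 definitions, 0 `Prop` facts, no instance, no notation) of the abc-iut cell — branch C certificate seat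
abc-iut-C-cert-1 (gen 9), row «W:HEX-UNIFORM-K» (abc-iut-plan C-R122 (a), optional item U1 (iii)). TAKES NO SIDE on [IUTchIII] Cor. 3.12
(S. Mochizuki, *Inter-universal Teichmüller theory III*, Cor. 3.12 p. 173–174; Step (xi-f) p. 184) or on any author; «inhabited as typed» ≠
«asserted in print». Parts U1 (i)/(ii) (`WRowHexLamSevenAllKEventually(Sharp).lean`) gave S_H ∀T beyond `l² > 16·abc_k` and above the odd bad primes /
`4·p^{⌊v_p/2⌋}`. THIS FILE: **`WRow.licence_lamSeven_allK_nonCyclotomic`** — for EVERY `k ≥ 1` and EVERY prime `l ≥ 5` that is NON-CYCLOTOMIC for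
`abc_k = (7^k+4)(7^k−4)·2·7^k` (every odd prime `p ∣ abc_k`: `p ≠ l`, `l ∤ p − 1`, and `v_p(abc_k) ≤ 1 ∨ 4·p^{⌊v_p(abc_k)/2⌋} < l` — hypothesis LEFT
SYMBOLIC in `k`), `Thm311ToCor312.Licence` at `settingPrVolSharp …` for every genuine datum over `(ratPoint (1/2 + 2/7^k), l)` and every pair of realising
ideles: abc-iut-C-cert-2's j-orbit socket `WRow.licence_orbit_of_nonCyclotomic` (`Conditional/WRowLicenceNonCyclotomicLevels`, over their
`WRow.licence_orbit_unconditional` p524300) at `q := 1/2 + 2/7^k`, `j(q) = j((7^k+4)/(2·7^k))` by `lamSeven_eq_hexK` — no `j ≠ 1728` input and no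
transport of `T` needed. READING (neutral): compared with U1 (ii) the conditions `p < l` are replaced by `p ≠ l ∧ l ∤ p − 1` (levels BELOW a bad prime are
allowed when non-cyclotomic), and squarefree bad primes impose nothing else. HONEST SCOPE: OUR sharp containers and Dupuy–Hilado's typed (Ind1)/(Ind2);
STRONGER-THAN-PRINT hull reading; admissibility / (P6) / non-emptiness NOT claimed; typed ≠ proved; instantiated ≠ endorsed; no abc claim.
[cite: Mochizuki2012, IUTchI Def. 3.1 (b),(c) pp. 61–62, Ex. 3.2 (iv) p. 71; IUTchIII Cor. 3.12 Step (xi-f) p. 184; IUTchIV Prop. 1.2 (i)(ii) p. 10, Prop. 1.4 (ii) p. 13, Cor. 2.2 (ii) proof (P5) p. 46] [cite: DupuyHilado2025, §3.3, §3.4, §4.9, §4.12] [claim: Mochizuki2012, status: disputed] for every IUT sentence quoted.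
-/

noncomputable section

open Set Function Metric NumberField IsDedekindDomain

namespace Summit.ABC.IUTFork.Conditional

open Thm311 Thm311.Real Cor312 Cor312Vol Cor312Prov Literature.IUT.LogThetaLattice Literature.IUT.LogVolume
  Literature.IUT.HodgeTheaters Literature.IUT.LogVolume.Cor22
open Literature.NumberTheory.NumberFields Literature.NumberTheory.GaloisRepresentations.Ultrametric
open Literature.NumberTheory.DiophantineGeometry Literature.NumberTheory.DiophantineGeometry.GenEll

/-- **«W:HEX-UNIFORM-K» (U1 (iii)): for EVERY `k ≥ 1` and EVERY NON-CYCLOTOMIC prime `l ≥ 5` of `abc_k = (7^k+4)(7^k−4)·2·7^k`** (every odd prime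
`p ∣ abc_k` has `p ≠ l`, `l ∤ p − 1`, and `v_p(abc_k) < 2 ∨ 4·p^{⌊v_p(abc_k)/2⌋} < l`): at every genuine Θ-volume datum over `(ratPoint (1/2 + 2/7^k), l)`
and every pair of realising Θ- and q-ideles, `Thm311ToCor312.Licence` HOLDS at `settingPrVolSharp …` — abc-iut-C-cert-2's
`WRow.licence_orbit_of_nonCyclotomic` at the HEX triple (`isABCTriple_hexK`) and `q := 1/2 + 2/7^k` (`lamSeven_eq_hexK`). [cite: Mochizuki2012, IUTchI Def. 3.1 (b),(c) pp. 61–62, Ex. 3.2 (iv) p. 71; IUTchIII Cor. 3.12 Step (xi-f) p. 184; IUTchIV Prop. 1.2 (i)(ii) p. 10, Prop. 1.4 (ii) p. 13, Cor. 2.2 (ii) proof (P5) p. 46] [cite: DupuyHilado2025, §3.3, §3.4, §4.9, §4.12] [claim: Mochizuki2012, status: disputed] -/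
theorem WRow.licence_lamSeven_allK_nonCyclotomic {k l : ℕ} (hk : 1 ≤ k) (hl : l.Prime) (hl5 : 5 ≤ l)
    (hnc : ∀ p : ℕ, p.Prime → p ∣ (7 ^ k + 4) * (7 ^ k - 4) * (2 * 7 ^ k) → p ≠ 2 →
      p ≠ l ∧ ¬ l ∣ p - 1 ∧ (((7 ^ k + 4) * (7 ^ k - 4) * (2 * 7 ^ k)).factorization p < 2 ∨ 4 * p ^ (((7 ^ k + 4) * (7 ^ k - 4) * (2 * 7 ^ k)).factorization p / 2) < l))
    (T : Cor22.ThetaVolumeDatumAt (ratPoint ((2 : ℚ)⁻¹ + 2 / 7 ^ k)) l) :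
    letI := T.instFieldF; letI := T.instNumberFieldF; letI := T.instAlgebraF; letI := T.instFieldK
    letI := T.instNumberFieldK; letI := T.instAlgebraK; letI := T.instFieldFbar; letI := T.instAlgebraFbar
    letI := T.instAlgebraKFbar; letI := T.instIsElliptic
    ∀ {logv : PadicLogs T.K} (hlog : LogvAnalytic logv) (M : Type) [Field M] [NumberField M]
      (archPk : ∀ (j : (thetaIndex (pilotDataOfK T.D T.K)).Label) (vQ : (thetaIndex (pilotDataOfK T.D T.K)).VQ),
        Set ((logShellsDH (pilotDataOfK T.D T.K) logv).Packet j vQ))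
      (archSub : ∀ (j : (thetaIndex (pilotDataOfK T.D T.K)).Label) (v : (thetaIndex (pilotDataOfK T.D T.K)).V),
        Set ((logShellsDH (pilotDataOfK T.D T.K) logv).Packet j ((thetaIndex (pilotDataOfK T.D T.K)).over v)))
      (Ψ : ℤ → ∀ v : (thetaIndex (pilotDataOfK T.D T.K)).V, v ∈ (thetaIndex (pilotDataOfK T.D T.K)).Vbad →
        Set ((logShellsDH (pilotDataOfK T.D T.K) logv).StarPacket v))
      (act : ℤ → ∀ v : (thetaIndex (pilotDataOfK T.D T.K)).V, v ∈ (thetaIndex (pilotDataOfK T.D T.K)).Vbad →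
        (logShellsDH (pilotDataOfK T.D T.K) logv).StarPacket v → Module.End ℚ ((logShellsDH (pilotDataOfK T.D T.K) logv).StarPacket v))
      (Mmod : ℤ → ∀ j : (thetaIndex (pilotDataOfK T.D T.K)).LabelStar, Set ((logShellsDH (pilotDataOfK T.D T.K) logv).GlobalPacket j.1))
      (region : ℤ → ∀ j : (thetaIndex (pilotDataOfK T.D T.K)).LabelStar, FinDivisor M → ∀ vQ : (thetaIndex (pilotDataOfK T.D T.K)).VQ,
        Set ((logShellsDH (pilotDataOfK T.D T.K) logv).Packet j.1 vQ))
      (n : ℤ) {HT : Type} {LogLink : HT → HT → Type} {IsFull : ∀ {s t : HT}, LogLink s t → Prop}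
      (lat : LGPGaussianLogThetaLattice LogLink IsFull)
      {Frd : Type} {IsoF : Frd → Frd → Type} {Ob : Frd → Type} {realify : Frd → Frd} {Strip : Type}
      {IsoS : Strip → Strip → Type} {Mv : ∀ v : (thetaIndex (pilotDataOfK T.D T.K)).V, v ∈ (thetaIndex (pilotDataOfK T.D T.K)).Vbad → Type}
      [∀ v h, Monoid (Mv v h)]
      (sig : GlobalLGPFrobenioidSignature (thetaIndex (pilotDataOfK T.D T.K)).lstar (thetaIndex (pilotDataOfK T.D T.K)).V
        (· ∈ (thetaIndex (pilotDataOfK T.D T.K)).Vbad) Frd IsoF Ob realify Strip IsoS Mv)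
      (split : SplittingMonoids Mv) {ObΔ : Type} {N : ∀ v : (thetaIndex (pilotDataOfK T.D T.K)).V, v ∈ (thetaIndex (pilotDataOfK T.D T.K)).Vbad → Type}
      [∀ v h, Monoid (N v h)] (qData : QPilotData ObΔ N)
      (tq : ∀ (pp : Nat.Primes) (x : (thetaIndex (pilotDataOfK T.D T.K)).Fibre (.inr pp)),
        haveI : Fact (pp : ℕ).Prime := ⟨pp.2⟩; kOf (pilotDataOfK T.D T.K) pp.1 x)
      (t : ∀ (pp : Nat.Primes) (_ : Fin (pilotDataOfK T.D T.K).lstar) (x : (thetaIndex (pilotDataOfK T.D T.K)).Fibre (.inr pp)),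
        haveI : Fact (pp : ℕ).Prime := ⟨pp.2⟩; kOf (pilotDataOfK T.D T.K) pp.1 x)
      (htq0 : ∀ pp x, tq pp x ≠ 0)
      (htq1 : ∀ (pp : Nat.Primes) (x : (thetaIndex (pilotDataOfK T.D T.K)).Fibre (.inr pp)),
        haveI : Fact (pp : ℕ).Prime := ⟨pp.2⟩; placeOf (pilotDataOfK T.D T.K) pp.1 x ∉ (pilotDataOfK T.D T.K).S → ‖tq pp x‖ = 1)
      (_ht0 : ∀ pp i x, t pp i x ≠ 0)
      (_ht : ∀ (pp : Nat.Primes) (i : Fin (pilotDataOfK T.D T.K).lstar) (x : (thetaIndex (pilotDataOfK T.D T.K)).Fibre (.inr pp)),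
        haveI : Fact (pp : ℕ).Prime := ⟨pp.2⟩
        Real.log ‖t pp i x‖ = -((pilotDataOfK T.D T.K).thetaPilot i (placeOf (pilotDataOfK T.D T.K) pp.1 x)) *
          logNorm T.K (placeOf (pilotDataOfK T.D T.K) pp.1 x) / localDegree T.K (placeOf (pilotDataOfK T.D T.K) pp.1 x))
      (_htq : ∀ (pp : Nat.Primes) (x : (thetaIndex (pilotDataOfK T.D T.K)).Fibre (.inr pp)),
        haveI : Fact (pp : ℕ).Prime := ⟨pp.2⟩
        Real.log ‖tq pp x‖ = -((pilotDataOfK T.D T.K).qPilot (placeOf (pilotDataOfK T.D T.K) pp.1 x)) *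
          logNorm T.K (placeOf (pilotDataOfK T.D T.K) pp.1 x) / localDegree T.K (placeOf (pilotDataOfK T.D T.K) pp.1 x)),
      Thm311ToCor312.Licence
        (settingPrVolSharp (pilotDataOfK T.D T.K) hlog M archPk archSub Ψ act Mmod region n lat sig split qData tq t htq0 htq1) := by
  exact WRow.licence_orbit_of_nonCyclotomic (isABCTriple_hexK hk) (q := (2 : ℚ)⁻¹ + 2 / 7 ^ k) (by rw [lamSeven_eq_hexK k]) hl hl5 hnc T

end Summit.ABC.IUTFork.Conditional

end
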